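import Literature.AlgebraicGeometry.Motives.GrassmannianChartNatural
import Mathlib.LinearAlgebra.Matrix.NonsingularInverse
import HarnessLib

/-!
# The transition cocycle of the standard charts of the Grassmannian (any rank `k`)

Topic `AlgebraicGeometry/Motives`; namespace `Literature.AlgebraicGeometry.Motives.Grassmannian`.  THEOREMS ONLY (no definition,
no instance, no notation, no named fact, no `sorry`).  Ring side of the cell's (h4) brick (Q3) «the universal quotient on the
Grassmannian scheme» (chart-side half, B-p18 (g18) under B-p21 (g16)); the rank-one case is ★ `GrassmannianOneChartTransition`
(B-p09 (g13), F4-1), whose statements are not repeated here.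

Setting: `R → A` commutative, `M` an `R`-module, `G(k, A ⊗_R M; A)` = Mathlib `Module.Grassmannian` (submodules `N` with
`(A ⊗ M)⧸N` finite projective of constant rank `k`), frames `x y z : Fin k → M`, the standard chart `chart R M k x A`
(★ `GrassmannianCharts`: the frame map `Aᵏ → (A ⊗ M)⧸N`, `eᵢ ↦ [1 ⊗ xᵢ]`, is bijective) and the chart coordinates
`coordMap x N hx : M →ₗ[R] Aᵏ` (★ `GrassmannianChartAffine`: `m ↦` the coordinates of `[1 ⊗ m]` in the frame `([1 ⊗ xᵢ])ᵢ`).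
For `N ∈ chart x A` the **transition matrix towards a second frame `y`** is

  `g_{xy}(N) := Matrix.of fun i i' => coordMap x N hx (y i') i ∈ M_k(A)`

(columns = the `x`-coordinates of the vectors `[1 ⊗ y_{i'}]`; written out in every statement, no definition).  We prove the
classical identities of [GortzWedhorn2020, (8.4) (pp. 213–215)] / [EisenbudHarris2016, §3.2.2] / [StacksProject, Tag 089T]:

* `mkQ_one_tmul_eq_frameMap_coordMap`, `mkQ_one_tmul_eq_sum_coordMap_smul` — `[1 ⊗ m] = Σᵢ (coordMap x N m)ᵢ · [1 ⊗ xᵢ]`;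
* `frameMap_eq_frameMap_transition_mulVec` — `frameMap y N a = frameMap x N (g_{xy} a)`, i.e. `frameMap y = frameMap x ∘ g_{xy}`
  (`frameMap_eq_frameMap_comp_mulVecLin`);
* **`mem_chart_iff_isUnit_transition`**, **`mem_chart_iff_isUnit_det_transition`** — for `N ∈ chart x A`:
  `N ∈ chart y A ↔ g_{xy}(N)` invertible `↔ det g_{xy}(N) ∈ A×` («`U_x ∩ U_y = D(det g_{xy}) ⊆ U_x`»);
* **`coordMap_eq_transition_mulVec`** — on `U_x ∩ U_y`: `coordMap x N m = g_{xy} · coordMap y N m` (the universal quotient's frames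
  differ by `g_{xy}`);
* **`transition_mul_transition`** — THE COCYCLE `g_{xy} g_{yz} = g_{xz}` (for `N ∈ chart x ∩ chart y`, `z` any family),
  `transition_self` (`g_{xx} = 1`), `transition_mul_transition_symm` (`g_{xy} g_{yx} = 1`);
* `transition_map` — naturality `g_{xy}(map f N) = f(g_{xy}(N))` along `R`-algebra maps `f : A → B` (★ `coordMap_map`).

These are exactly the data of a Čech `1`-cocycle of invertible matrices on the standard open cover of the Grassmannian (consumed
scheme-side through ★ `Modules/MatrixCocycleGluing` or through the tautological affine family).  Cell `hodgecm-mathlib` (D-0151),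
count-neutral Mathlib-side capital; nothing here is about HC — HC_CM is proved only modulo the 7 printed citations until rung 0 closes.

## References
* [GortzWedhorn2020] U. Görtz, T. Wedhorn, *Algebraic Geometry I*, 2nd ed. (2020), (8.4) (pp. 213–215).
* [EisenbudHarris2016] D. Eisenbud, J. Harris, *3264 and All That* (2016), §3.2.2 (the affine cover of the Grassmannian).
* [StacksProject] The Stacks project, Tag 089T (the standard open cover of `G(k, n)`).
* [Hartshorne1977] R. Hartshorne, *Algebraic Geometry* (1977), II Ex. 5.18 (p. 128) (transition matrices of a locally free sheaf).
-/

universe u v w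

open TensorProduct Matrix

namespace Literature.AlgebraicGeometry.Motives

namespace Grassmannian

variable {R : Type u} [CommRing R] {M : Type v} [AddCommGroup M] [Module R M] {k : ℕ}
variable {A : Type w} [CommRing A] [Algebra R A] {B : Type w} [CommRing B] [Algebra R B]

/-! ## §1 Coordinates expand `[1 ⊗ m]` in the frame -/

/-- `[1 ⊗ m] = frameMap x N (coordMap x N m)` in `(A ⊗ M)⧸N` for `N ∈ chart x A` (definition of the coordinates, unfolded).
[cite: StacksProject, Tag 089T] -/
theorem mkQ_one_tmul_eq_frameMap_coordMap (x : Fin k → M) (N : Module.Grassmannian A (A ⊗[R] M) k)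
    (hx : N ∈ chart R M k x A) (m : M) :
    N.toSubmodule.mkQ ((1 : A) ⊗ₜ[R] m) = frameMap x N.toSubmodule (coordMap x N hx m) := by
  rw [coordMap_apply, ← frameEquiv_apply x N hx, LinearEquiv.apply_symm_apply]

/-- **`[1 ⊗ m] = Σᵢ (coordMap x N m)ᵢ · [1 ⊗ xᵢ]`** in `(A ⊗ M)⧸N` for `N ∈ chart x A`.
[cite: GortzWedhorn2020, (8.4) (pp. 213–215)] [cite: StacksProject, Tag 089T] -/
theorem mkQ_one_tmul_eq_sum_coordMap_smul (x : Fin k → M) (N : Module.Grassmannian A (A ⊗[R] M) k)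
    (hx : N ∈ chart R M k x A) (m : M) :
    N.toSubmodule.mkQ ((1 : A) ⊗ₜ[R] m) = ∑ i, coordMap x N hx m i • N.toSubmodule.mkQ ((1 : A) ⊗ₜ[R] x i) := by
  rw [mkQ_one_tmul_eq_frameMap_coordMap x N hx m, frameMap, Fintype.linearCombination_apply]

/-! ## §2 The frame map at `y` factors through the frame map at `x` via `g_{xy}` -/

/-- The transition matrix applied to a standard basis vector is a column: `g_{xy} e_{i'} = coordMap x N (y i')`.
[cite: StacksProject, Tag 089T] -/
theorem transition_mulVec_single (x y : Fin k → M) (N : Module.Grassmannian A (A ⊗[R] M) k)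
    (hx : N ∈ chart R M k x A) (i' : Fin k) :
    (Matrix.of fun i j => coordMap x N hx (y j) i) *ᵥ Pi.single i' (1 : A) = coordMap x N hx (y i') := by
  rw [Matrix.mulVec_single_one]
  rfl

/-- **`frameMap y N = frameMap x N ∘ g_{xy}`** as linear maps `Aᵏ → (A ⊗ M)⧸N`, for `N ∈ chart x A` and any frame `y`.
[cite: GortzWedhorn2020, (8.4) (pp. 213–215)] [cite: EisenbudHarris2016, §3.2.2] -/
theorem frameMap_eq_frameMap_comp_mulVecLin (x y : Fin k → M) (N : Module.Grassmannian A (A ⊗[R] M) k)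
    (hx : N ∈ chart R M k x A) :
    frameMap y N.toSubmodule =
      frameMap x N.toSubmodule ∘ₗ Matrix.mulVecLin (Matrix.of fun i j => coordMap x N hx (y j) i) := by
  refine LinearMap.pi_ext' fun i' => LinearMap.ext_ring ?_
  simp only [LinearMap.comp_apply, LinearMap.coe_single, Matrix.mulVecLin_apply]
  rw [transition_mulVec_single x y N hx i', ← mkQ_one_tmul_eq_frameMap_coordMap x N hx (y i'), frameMap_single]

/-- `frameMap y N a = frameMap x N (g_{xy} a)` (pointwise form). [cite: GortzWedhorn2020, (8.4) (pp. 213–215)] -/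
theorem frameMap_eq_frameMap_transition_mulVec (x y : Fin k → M) (N : Module.Grassmannian A (A ⊗[R] M) k)
    (hx : N ∈ chart R M k x A) (a : Fin k → A) :
    frameMap y N.toSubmodule a = frameMap x N.toSubmodule ((Matrix.of fun i j => coordMap x N hx (y j) i) *ᵥ a) := by
  rw [frameMap_eq_frameMap_comp_mulVecLin x y N hx, LinearMap.comp_apply, Matrix.mulVecLin_apply]

/-! ## §3 Membership in a second chart: `U_x ∩ U_y = D(det g_{xy})` -/

/-- Over a commutative ring, `a ↦ g a` is bijective iff the square matrix `g` is invertible. [folklore] -/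
private theorem mulVec_bijective_iff_isUnit {n : Type*} [Fintype n] [DecidableEq n] (g : Matrix n n A) :
    Function.Bijective g.mulVec ↔ IsUnit g := by
  refine ⟨fun h => Matrix.mulVec_surjective_iff_isUnit.mp h.2, fun h => ⟨?_, Matrix.mulVec_surjective_iff_isUnit.mpr h⟩⟩
  intro a b hab
  have h1 : (↑h.unit⁻¹ : Matrix n n A) *ᵥ (g *ᵥ a) = (↑h.unit⁻¹ : Matrix n n A) *ᵥ (g *ᵥ b) := by rw [hab]
  rwa [Matrix.mulVec_mulVec, Matrix.mulVec_mulVec, IsUnit.val_inv_mul, Matrix.one_mulVec, Matrix.one_mulVec] at h1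

/-- **Membership in a second chart**: for `N ∈ chart x A`, `N ∈ chart y A ↔` the transition matrix `g_{xy}(N)` is invertible.
[cite: GortzWedhorn2020, (8.4) (pp. 213–215)] [cite: StacksProject, Tag 089T] -/
theorem mem_chart_iff_isUnit_transition (x y : Fin k → M) (N : Module.Grassmannian A (A ⊗[R] M) k)
    (hx : N ∈ chart R M k x A) :
    N ∈ chart R M k y A ↔ IsUnit (Matrix.of fun i j => coordMap x N hx (y j) i) := by
  classical
  rw [mem_chart_iff, frameMap_eq_frameMap_comp_mulVecLin x y N hx, LinearMap.coe_comp,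
    Function.Bijective.of_comp_iff' hx, Matrix.coe_mulVecLin, mulVec_bijective_iff_isUnit]

/-- **`U_x ∩ U_y = D(det g_{xy}) ⊆ U_x`**: for `N ∈ chart x A`, `N ∈ chart y A ↔ det g_{xy}(N) ∈ A×`.
[cite: GortzWedhorn2020, (8.4) (pp. 213–215)] [cite: StacksProject, Tag 089T] -/
theorem mem_chart_iff_isUnit_det_transition (x y : Fin k → M) (N : Module.Grassmannian A (A ⊗[R] M) k)
    (hx : N ∈ chart R M k x A) :
    N ∈ chart R M k y A ↔ IsUnit (Matrix.of fun i j => coordMap x N hx (y j) i).det := by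
  rw [mem_chart_iff_isUnit_transition x y N hx, Matrix.isUnit_iff_isUnit_det]

/-! ## §4 Change of coordinates and the cocycle -/

/-- **Change of coordinates on `U_x ∩ U_y`**: `coordMap x N m = g_{xy}(N) · coordMap y N m` — the two frames of the universal
quotient differ by the transition matrix. [cite: GortzWedhorn2020, (8.4) (pp. 213–215)] [cite: Hartshorne1977, II Ex. 5.18 (p. 128)] -/
theorem coordMap_eq_transition_mulVec (x y : Fin k → M) (N : Module.Grassmannian A (A ⊗[R] M) k)
    (hx : N ∈ chart R M k x A) (hy : N ∈ chart R M k y A) (m : M) :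
    coordMap x N hx m = (Matrix.of fun i j => coordMap x N hx (y j) i) *ᵥ coordMap y N hy m := by
  apply hx.1
  rw [← frameMap_eq_frameMap_transition_mulVec x y N hx, ← mkQ_one_tmul_eq_frameMap_coordMap x N hx m,
    ← mkQ_one_tmul_eq_frameMap_coordMap y N hy m]

/-- **THE COCYCLE CONDITION `g_{xy} g_{yz} = g_{xz}`** for `N ∈ chart x A ∩ chart y A` and any family `z : Fin k → M`.
[cite: Hartshorne1977, II Ex. 5.18 (p. 128)] [cite: GortzWedhorn2020, (8.4) (pp. 213–215)] -/
theorem transition_mul_transition (x y z : Fin k → M) (N : Module.Grassmannian A (A ⊗[R] M) k)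
    (hx : N ∈ chart R M k x A) (hy : N ∈ chart R M k y A) :
    (Matrix.of fun i j => coordMap x N hx (y j) i) * (Matrix.of fun i j => coordMap y N hy (z j) i) =
      Matrix.of fun i j => coordMap x N hx (z j) i := by
  ext i j
  have h := congrFun (coordMap_eq_transition_mulVec x y N hx hy (z j)) i
  simp only [Matrix.mul_apply, Matrix.of_apply, Matrix.mulVec, dotProduct] at h ⊢
  exact h.symm

/-- `g_{xx} = 1`. [cite: StacksProject, Tag 089T] -/
theorem transition_self (x : Fin k → M) (N : Module.Grassmannian A (A ⊗[R] M) k) (hx : N ∈ chart R M k x A) :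
    (Matrix.of fun i j => coordMap x N hx (x j) i) = 1 := by
  ext i j
  rw [Matrix.of_apply, coordMap_frame, Matrix.one_apply, Pi.single_apply]

/-- **`g_{xy} g_{yx} = 1`**: the two transition matrices on `U_x ∩ U_y` are mutually inverse.
[cite: Hartshorne1977, II Ex. 5.18 (p. 128)] [cite: GortzWedhorn2020, (8.4) (pp. 213–215)] -/
theorem transition_mul_transition_symm (x y : Fin k → M) (N : Module.Grassmannian A (A ⊗[R] M) k)
    (hx : N ∈ chart R M k x A) (hy : N ∈ chart R M k y A) :
    (Matrix.of fun i j => coordMap x N hx (y j) i) * (Matrix.of fun i j => coordMap y N hy (x j) i) = 1 := by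
  rw [transition_mul_transition x y x N hx hy, transition_self]

/-- The determinants of `g_{xy}` and `g_{yx}` are mutually inverse. [cite: Hartshorne1977, II Ex. 5.18 (p. 128)] -/
theorem det_transition_mul_det_transition_symm (x y : Fin k → M) (N : Module.Grassmannian A (A ⊗[R] M) k)
    (hx : N ∈ chart R M k x A) (hy : N ∈ chart R M k y A) :
    (Matrix.of fun i j => coordMap x N hx (y j) i).det * (Matrix.of fun i j => coordMap y N hy (x j) i).det = 1 := by
  rw [← Matrix.det_mul, transition_mul_transition_symm x y N hx hy, Matrix.det_one]

/-! ## §5 Naturality along ring maps -/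

/-- **Naturality of the transition matrix**: `g_{xy}(map f N) = f (g_{xy}(N))` entrywise, for an `R`-algebra map `f : A → B`
(★ `coordMap_map`). [cite: StacksProject, Tag 089T] [cite: EisenbudHarris2016, §3.2.2] -/
theorem transition_map (f : A →ₐ[R] B) (x y : Fin k → M) (N : Module.Grassmannian A (A ⊗[R] M) k)
    (hx : N ∈ chart R M k x A) :
    (Matrix.of fun i j => coordMap x (Module.Grassmannian.map f N) (map_mem_chart f hx) (y j) i) =
      (Matrix.of fun i j => coordMap x N hx (y j) i).map f := by
  ext i j
  rw [Matrix.of_apply, Matrix.map_apply, Matrix.of_apply, coordMap_map f x N hx]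
  rfl

/-- Naturality of the determinant of the transition matrix. [cite: StacksProject, Tag 089T] -/
theorem det_transition_map (f : A →ₐ[R] B) (x y : Fin k → M) (N : Module.Grassmannian A (A ⊗[R] M) k)
    (hx : N ∈ chart R M k x A) :
    (Matrix.of fun i j => coordMap x (Module.Grassmannian.map f N) (map_mem_chart f hx) (y j) i).det =
      f (Matrix.of fun i j => coordMap x N hx (y j) i).det := by
  rw [transition_map f x y N hx, ← AlgHom.coe_toRingHom, RingHom.map_det, RingHom.mapMatrix_apply]

end Grassmannian

end Literature.AlgebraicGeometry.Motives
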